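import Summits.CriticalPhenomena.Ising3DConformalLimit.Theorems.EnergyNotSigmaSquaredGapForcesFarMergingScreeningDefsAnnular
import Summits.CriticalPhenomena.Ising3DConformalLimit.Theorems.EnergyNotSigmaSquaredGapForcesFarMergingFloorsReduction
import Summits.CriticalPhenomena.Ising3DConformalLimit.Theorems.EnergyNotSigmaSquaredGapForcesFarMergingFloorsNecessity
import Summits.CriticalPhenomena.Ising3DConformalLimit.Theorems.EnergyNotSigmaSquaredGapForcesFarMergingRootOpacityScreen

/-! # Near-source insensitivity from a deterministic-obstacle oscillation bound
(line `screening-form-lemma-a1` of crux `GapForcesFarMerging`, item stmt-CriticalPhenomena-4468;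
helper file of the open stub `stub_nearSource : NearSourceInsensitivity`, currency of `Theorems/…ScreeningDefsAnnular.lean`)

`NearSourceInsensitivity` moves the near source of the probe pair `(e₂, dn M)`, `M = 2^{K+3}`, from the pinch
`e₂` to a deep interior point `2^{k-j}u`, `u ∈ F`, at the additive cost `μ/2` in the UNTILTED mean annular
screening `annScreen n k 0 (up M) a (dn M) = E^{0,up M;∅}_{Λ_n}[𝟙[dn M ∉ C]·S⁽ⁿ⁾_{a,dn M}(C_{2^{k+1}}(0) ∖ Λ_{2^k})]`
(resp. the outer screening at a bulk step). The explored cluster `C` of the strand `0 → up M` is INDEPENDENT of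
the probe and the integrand depends on the near source `a` only through the deterministic screening ratio
`S⁽ⁿ⁾_{ab}(T) = ⟨σ_aσ_b⟩_{Λ_n∖T}/⟨σ_aσ_b⟩_{Λ_n}` evaluated at the random obstacle `T_ω = C_{2^{k+1}}(0) ∖ Λ_{2^k}`
(`⊆ Λ_{2^{k+1}} ∖ Λ_{2^k}`) resp. `T_ω = C_n(0) ∖ Λ_{2^K}` (`⊆ Λ_n ∖ Λ_{2^K}`, off `dn M`), with the SAME indicator
`𝟙[dn M ∉ C]` for every near source. Hence the stub follows from a DETERMINISTIC-OBSTACLE OSCILLATION BOUND,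
averaged over the finite family `F` (the existential `∃ u ∈ F` must come out of the integral, so an average —
not a minimum — over `F` is integrated): for all obstacles `T` in the annulus (resp. beyond `Λ_{2^K}`, off
`dn M`), `∑_{u∈F} S_{2^{k-j}u, dn M}(T) ≤ |F|·(S_{e₂, dn M}(T) + μ/2)`. Integrating against the one-strand box
law (a probability measure once `up M ∈ Λ_n`; every bounded functional is integrable) gives
`∑_u annScreen(2^{k-j}u) ≤ |F|·(annScreen(e₂) + μ/2) ≤ |F|·(1 - μ/2)`, and a pigeonhole over `F` picks `u`.
This is the registered reduction `nearSource_of_screeningOscillation`; its multiplicative special case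
`nearSource_of_twoPointDoubleRatio` (one deep source `2^{k-j}e₃`, `F = {e₃}`: the double ratio
`⟨σ_vσ_z⟩_{Λ_n∖T}⟨σ_{e₂}σ_z⟩_{Λ_n} ≤ (1+ε)⟨σ_{e₂}σ_z⟩_{Λ_n∖T}⟨σ_vσ_z⟩_{Λ_n}` gives `S_v(T) ≤ (1+ε)S_{e₂}(T) ≤ S_{e₂}(T) + ε`)
states the missing input in the vocabulary of the depleted box two-point function alone. The oscillation bound
itself — an interior-Harnack / re-rooting statement for ONE sourced critical current and its depleted vacuum against
far obstacles on `ℤ³`, uniform in the scale — is NOT proved here (Aizenman–Duminil-Copin 2021 §6.2, Thm 6.4 and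
(6.16) give it in `d = 4` with a rate; Panis 2025 Thm 2.4 is the qualitative `d ≥ 3` mixing at fixed scales).
References: Aizenman–Duminil-Copin 2021 (arXiv:1912.07973) §6.2, App. A Lemma A.1;
Aizenman–Duminil-Copin–Sidoravicius 2015 Lemma 2.2; R. Panis, PTRF 194 (2025) Thm 2.4. -/

noncomputable section

namespace Summit.CriticalPhenomena.Ising3DConformalLimit.EnergyNotSigmaSquaredGapForcesFarMerging

open scoped symmDiff ENNReal
open MeasureTheory Filter Finset
open Literature.Probability.LatticeModels Literature.Probability.Percolation
open Summit.CriticalPhenomena.Ising3DConformalLimit.Theorems.GapForcesFarMerging.Negative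
  (e₁ e₂ cc2 xR up dn FarMergingShape SinglePinchLawShape)
open Summit.CriticalPhenomena.Ising3DConformalLimit.GapForcesFarMergingScreening

/-! ### The random obstacles and the weights -/

/-- The annular piece lies in the annulus `Λ_{2^{k+1}} ∖ Λ_{2^k}`. [folklore] -/
theorem nearSrc_annPiece_subset (k : ℕ) (o : Site 3) (ω : BondConfig (Site 3)) :
    annPiece k o ω ⊆ box 3 (2 ^ (k + 1)) \ box 3 (2 ^ k) :=
  Finset.sdiff_subset_sdiff (innerCluster_subset_box _ o ω) le_rfl

/-- The outer piece lies in `Λ_n ∖ Λ_{2^K}`. [folklore] -/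
theorem nearSrc_outerPiece_subset (n K : ℕ) (o : Site 3) (ω : BondConfig (Site 3)) :
    outerPiece n K o ω ⊆ box 3 n \ box 3 (2 ^ K) :=
  Finset.sdiff_subset_sdiff (innerCluster_subset_box _ o ω) le_rfl

/-- A point off the full cluster is off the outer piece. [folklore] -/
theorem nearSrc_not_mem_outerPiece {n K : ℕ} {b o : Site 3} {ω : BondConfig (Site 3)}
    (hb : b ∉ openCluster ω o) : b ∉ outerPiece n K o ω := fun h =>
  hb (innerCluster_subset_openCluster n o ω _ (Finset.mem_sdiff.1 h).1)

/-- `|annWeight| ≤ |⟨σ_aσ_b⟩_{Λ_n}|⁻¹`, a bound uniform in the configuration. [folklore] -/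
theorem nearSrc_abs_annWeight_le (n k : ℕ) (o a b : Site 3) (ω : BondConfig (Site 3)) :
    |annWeight n k o a b ω| ≤ |boxTwoPoint n ∅ a b|⁻¹ := by
  classical
  unfold annWeight
  split_ifs
  · rw [abs_zero]; exact inv_nonneg.2 (abs_nonneg _)
  · exact floorsRed_abs_screening_le n _ a b

/-- `|outerWeight| ≤ |⟨σ_aσ_b⟩_{Λ_n}|⁻¹`. [folklore] -/
theorem nearSrc_abs_outerWeight_le (n K : ℕ) (o a b : Site 3) (ω : BondConfig (Site 3)) :
    |outerWeight n K o a b ω| ≤ |boxTwoPoint n ∅ a b|⁻¹ := by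
  classical
  unfold outerWeight
  split_ifs
  · rw [abs_zero]; exact inv_nonneg.2 (abs_nonneg _)
  · exact floorsRed_abs_screening_le n _ a b

/-! ### Pointwise: the oscillation bound transfers to the weights (same indicator for every near source) -/

/-- **Pointwise transfer (annular)**: if `∑_{u∈F} S_{src u, b}(T) ≤ |F|·(S_{a,b}(T) + δ)` for every obstacle `T`
in the annulus `Λ_{2^{k+1}} ∖ Λ_{2^k}`, then `∑_{u∈F} annWeight(src u) ≤ |F|·annWeight(a) + |F|·δ` at every
configuration (the obstacle `T_ω = C_{2^{k+1}}(0) ∖ Λ_{2^k}` is such a `T`; the indicator `𝟙[b ∉ C]` is common). [folklore] -/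
theorem nearSrc_sum_annWeight_le {n k : ℕ} {o a b : Site 3} {F : Finset (Site 3)} {src : Site 3 → Site 3}
    {δ : ℝ} (hδ : 0 ≤ δ)
    (h : ∀ T : Finset (Site 3), T ⊆ box 3 (2 ^ (k + 1)) \ box 3 (2 ^ k) →
      ∑ u ∈ F, screening n T (src u) b ≤ #F * (screening n T a b + δ))
    (ω : BondConfig (Site 3)) :
    ∑ u ∈ F, annWeight n k o (src u) b ω ≤ #F * annWeight n k o a b ω + #F * δ := by
  classical
  unfold annWeight
  by_cases hb : b ∈ openCluster ω o
  · simp only [if_pos hb, Finset.sum_const_zero, mul_zero, zero_add]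
    positivity
  · simp only [if_neg hb]
    have := h (annPiece k o ω) (nearSrc_annPiece_subset k o ω)
    linarith

/-- **Pointwise transfer (outer)**: if `∑_{u∈F} S_{src u, b}(T) ≤ |F|·(S_{a,b}(T) + δ)` for every obstacle
`T ⊆ Λ_n ∖ Λ_{2^K}` off `b`, then `∑_{u∈F} outerWeight(src u) ≤ |F|·outerWeight(a) + |F|·δ` at every configuration
(on `{b ∉ C}` the obstacle `T_ω = C_n(0) ∖ Λ_{2^K}` is such a `T`). [folklore] -/
theorem nearSrc_sum_outerWeight_le {n K : ℕ} {o a b : Site 3} {F : Finset (Site 3)} {src : Site 3 → Site 3}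
    {δ : ℝ} (hδ : 0 ≤ δ)
    (h : ∀ T : Finset (Site 3), T ⊆ box 3 n \ box 3 (2 ^ K) → b ∉ T →
      ∑ u ∈ F, screening n T (src u) b ≤ #F * (screening n T a b + δ))
    (ω : BondConfig (Site 3)) :
    ∑ u ∈ F, outerWeight n K o (src u) b ω ≤ #F * outerWeight n K o a b ω + #F * δ := by
  classical
  unfold outerWeight
  by_cases hb : b ∈ openCluster ω o
  · simp only [if_pos hb, Finset.sum_const_zero, mul_zero, zero_add]
    positivity
  · simp only [if_neg hb]
    have := h (outerPiece n K o ω) (nearSrc_outerPiece_subset n K o ω) (nearSrc_not_mem_outerPiece hb)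
    linarith

/-! ### Integrated: the mean screenings, and the pigeonhole over `F` -/

/-- **Integrated transfer (annular)**: under the annular oscillation bound,
`∑_{u∈F} annScreen(src u) ≤ |F|·annScreen(a) + |F|·δ` (far strand end `x ∈ Λ_n`, so that the box law is a
probability measure; every weight is bounded, hence integrable). [folklore] -/
theorem nearSrc_sum_annScreen_le {n k : ℕ} {x a b : Site 3} (hx : x ∈ box 3 n) {F : Finset (Site 3)}
    {src : Site 3 → Site 3} {δ : ℝ} (hδ : 0 ≤ δ)
    (h : ∀ T : Finset (Site 3), T ⊆ box 3 (2 ^ (k + 1)) \ box 3 (2 ^ k) →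
      ∑ u ∈ F, screening n T (src u) b ≤ #F * (screening n T a b + δ)) :
    ∑ u ∈ F, annScreen n k 0 x (src u) b ≤ #F * annScreen n k 0 x a b + #F * δ := by
  haveI := floorsRed_isProbabilityMeasure (n := n) hx
  have hint : ∀ u ∈ F, Integrable (fun ω => annWeight n k 0 (src u) b ω)
      (sourcedDoubleCurrentLaw 3 n (criticalBeta 3) ({0} ∆ {x}) ∅) := fun u _ =>
    floorsRed_integrable _ (nearSrc_abs_annWeight_le n k 0 (src u) b)
  have ha : Integrable (fun ω => annWeight n k 0 a b ω)
      (sourcedDoubleCurrentLaw 3 n (criticalBeta 3) ({0} ∆ {x}) ∅) :=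
    floorsRed_integrable _ (nearSrc_abs_annWeight_le n k 0 a b)
  unfold annScreen
  rw [← integral_finsetSum F hint]
  calc ∫ ω, ∑ u ∈ F, annWeight n k 0 (src u) b ω ∂(sourcedDoubleCurrentLaw 3 n (criticalBeta 3) ({0} ∆ {x}) ∅)
      ≤ ∫ ω, ((#F : ℝ) * annWeight n k 0 a b ω + #F * δ)
          ∂(sourcedDoubleCurrentLaw 3 n (criticalBeta 3) ({0} ∆ {x}) ∅) :=
        integral_mono (integrable_finsetSum F hint) ((ha.const_mul _).add (integrable_const _))
          fun ω => nearSrc_sum_annWeight_le hδ h ω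
    _ = #F * ∫ ω, annWeight n k 0 a b ω ∂(sourcedDoubleCurrentLaw 3 n (criticalBeta 3) ({0} ∆ {x}) ∅) + #F * δ := by
        rw [integral_add (ha.const_mul _) (integrable_const _), integral_const_mul, integral_const]
        simp

/-- **Integrated transfer (outer)**: under the outer oscillation bound,
`∑_{u∈F} outerScreen(src u) ≤ |F|·outerScreen(a) + |F|·δ`. [folklore] -/
theorem nearSrc_sum_outerScreen_le {n K : ℕ} {x a b : Site 3} (hx : x ∈ box 3 n) {F : Finset (Site 3)}
    {src : Site 3 → Site 3} {δ : ℝ} (hδ : 0 ≤ δ)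
    (h : ∀ T : Finset (Site 3), T ⊆ box 3 n \ box 3 (2 ^ K) → b ∉ T →
      ∑ u ∈ F, screening n T (src u) b ≤ #F * (screening n T a b + δ)) :
    ∑ u ∈ F, outerScreen n K 0 x (src u) b ≤ #F * outerScreen n K 0 x a b + #F * δ := by
  haveI := floorsRed_isProbabilityMeasure (n := n) hx
  have hint : ∀ u ∈ F, Integrable (fun ω => outerWeight n K 0 (src u) b ω)
      (sourcedDoubleCurrentLaw 3 n (criticalBeta 3) ({0} ∆ {x}) ∅) := fun u _ =>
    floorsRed_integrable _ (nearSrc_abs_outerWeight_le n K 0 (src u) b)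
  have ha : Integrable (fun ω => outerWeight n K 0 a b ω)
      (sourcedDoubleCurrentLaw 3 n (criticalBeta 3) ({0} ∆ {x}) ∅) :=
    floorsRed_integrable _ (nearSrc_abs_outerWeight_le n K 0 a b)
  unfold outerScreen
  rw [← integral_finsetSum F hint]
  calc ∫ ω, ∑ u ∈ F, outerWeight n K 0 (src u) b ω ∂(sourcedDoubleCurrentLaw 3 n (criticalBeta 3) ({0} ∆ {x}) ∅)
      ≤ ∫ ω, ((#F : ℝ) * outerWeight n K 0 a b ω + #F * δ)
          ∂(sourcedDoubleCurrentLaw 3 n (criticalBeta 3) ({0} ∆ {x}) ∅) :=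
        integral_mono (integrable_finsetSum F hint) ((ha.const_mul _).add (integrable_const _))
          fun ω => nearSrc_sum_outerWeight_le hδ h ω
    _ = #F * ∫ ω, outerWeight n K 0 a b ω ∂(sourcedDoubleCurrentLaw 3 n (criticalBeta 3) ({0} ∆ {x}) ∅) + #F * δ := by
        rw [integral_add (ha.const_mul _) (integrable_const _), integral_const_mul, integral_const]
        simp

/-- **Pigeonhole over the family**: if `∑_{u∈F} f u ≤ |F|·g + |F|·(μ/2)` with `g ≤ 1 - μ` and `F ≠ ∅`, then some
`u ∈ F` has `f u ≤ 1 - μ/2`. [folklore] -/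
theorem nearSrc_exists_le {F : Finset (Site 3)} (hF : F.Nonempty) {f : Site 3 → ℝ} {g μ : ℝ}
    (hsum : ∑ u ∈ F, f u ≤ #F * g + #F * (μ / 2)) (hg : g ≤ 1 - μ) : ∃ u ∈ F, f u ≤ 1 - μ / 2 := by
  refine Finset.exists_le_of_sum_le hF ?_
  rw [Finset.sum_const, nsmul_eq_mul]
  have hF0 : (0 : ℝ) ≤ #F := Nat.cast_nonneg _
  nlinarith

/-! ### The reduction, for an arbitrary side condition on the family, and the registered instance -/

/-- **The transfer, general side condition.** For ANY side condition `Q j F` on the granularity and the family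
(e.g. `∀ u ∈ F, u₂ ≠ 0`, or additionally `F ⊆ Λ_{2^j}`): the deterministic-obstacle oscillation bound, octave and
bulk forms, averaged over a finite nonempty family `F`, implies the near-source insensitivity statement with the
same `j`, `F` (and the same side condition). Proof: integrate the pointwise transfer at the random obstacle against
the one-strand box law (`up 2^{K+3} ∈ Λ_n` eventually) and pigeonhole over `F`. [folklore] -/
theorem nearSrc_transfer (Q : ℕ → Finset (Site 3) → Prop)
    (h : ∀ μ : ℝ, 0 < μ → ∃ j : ℕ, ∃ F : Finset (Site 3), F.Nonempty ∧ Q j F ∧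
      (∀ᶠ k : ℕ in atTop, ∀ K : ℕ, k < K → ∀ᶠ n : ℕ in atTop, ∀ T : Finset (Site 3),
        T ⊆ box 3 (2 ^ (k + 1)) \ box 3 (2 ^ k) →
          ∑ u ∈ F, screening n T (deepSource k j u) (dn (2 ^ (K + 3))) ≤
            #F * (screening n T e₂ (dn (2 ^ (K + 3))) + μ / 2)) ∧
      (∀ᶠ K : ℕ in atTop, ∀ᶠ n : ℕ in atTop, ∀ T : Finset (Site 3), T ⊆ box 3 n \ box 3 (2 ^ K) →
        dn (2 ^ (K + 3)) ∉ T →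
          ∑ u ∈ F, screening n T (deepSource K j u) (dn (2 ^ (K + 3))) ≤
            #F * (screening n T e₂ (dn (2 ^ (K + 3))) + μ / 2))) :
    ∀ μ : ℝ, 0 < μ → ∃ j : ℕ, ∃ F : Finset (Site 3), F.Nonempty ∧ Q j F ∧
      (∀ᶠ k : ℕ in atTop, ∀ K : ℕ, k < K → ∀ᶠ n : ℕ in atTop,
        annScreen n k 0 (up (2 ^ (K + 3))) e₂ (dn (2 ^ (K + 3))) ≤ 1 - μ →
          ∃ u ∈ F, annScreen n k 0 (up (2 ^ (K + 3))) (deepSource k j u) (dn (2 ^ (K + 3))) ≤ 1 - μ / 2) ∧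
      (∀ᶠ K : ℕ in atTop, ∀ᶠ n : ℕ in atTop,
        outerScreen n K 0 (up (2 ^ (K + 3))) e₂ (dn (2 ^ (K + 3))) ≤ 1 - μ →
          ∃ u ∈ F, outerScreen n K 0 (up (2 ^ (K + 3))) (deepSource K j u) (dn (2 ^ (K + 3))) ≤ 1 - μ / 2) := by
  intro μ hμ
  obtain ⟨j, F, hF, hQ, hoct, hbulk⟩ := h μ hμ
  have hμ2 : 0 ≤ μ / 2 := by positivity
  refine ⟨j, F, hF, hQ, ?_, ?_⟩
  · filter_upwards [hoct] with k hk K hkK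
    filter_upwards [hk K hkK, floorsRed_eventually_mem_box (2 ^ (K + 3))] with n hn hbox hscreen
    exact nearSrc_exists_le hF (nearSrc_sum_annScreen_le hbox.1 hμ2 hn) hscreen
  · filter_upwards [hbulk] with K hK
    filter_upwards [hK, floorsRed_eventually_mem_box (2 ^ (K + 3))] with n hn hbox hscreen
    exact nearSrc_exists_le hF (nearSrc_sum_outerScreen_le hbox.1 hμ2 hn) hscreen

/-- **NEAR-SOURCE INSENSITIVITY FROM THE DETERMINISTIC-OBSTACLE OSCILLATION BOUND** — registered helper of the open
stub `stub_nearSource`. IF for every `μ > 0` there are a granularity `j` and a finite nonempty family `F` off the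
plane `{u₂ = 0}` such that (octave form) for all large `k`, every `K > k` and all large `n`, for EVERY obstacle
`T ⊆ Λ_{2^{k+1}} ∖ Λ_{2^k}` the screening ratios of the far probe end `dn 2^{K+3}` satisfy
`∑_{u∈F} S⁽ⁿ⁾_{2^{k-j}u, dn}(T) ≤ |F|·(S⁽ⁿ⁾_{e₂, dn}(T) + μ/2)` (the probe from a deep interior source is, on average
over `F`, cut by a far obstacle at most `μ/2` less often than the probe from the pinch), and (bulk form) the same
for all large `K`, large `n` and every `T ⊆ Λ_n ∖ Λ_{2^K}` off `dn 2^{K+3}` with the sources `2^{K-j}u`, THEN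
`NearSourceInsensitivity` holds (same `j`, `F`; `nearSrc_transfer` with the side condition `∀ u ∈ F, u₂ ≠ 0` — any
other side condition, e.g. `F ⊆ Λ_{2^j}`, is carried along verbatim by `nearSrc_transfer`). The cluster of the strand
is independent of the probe, so only the pointwise bound at the random obstacle `T_ω` (same indicator `𝟙[dn ∉ C]`
for all sources) is integrated. The hypothesis is the `ℤ³`, uniform-in-scale analogue of the source re-rooting step
of Aizenman–Duminil-Copin 2021, §6.2 (6.16); it is NOT proved here. [cite: AizenmanDuminilCopinAnnals2021, §6.2, eq. (6.16)] -/
theorem nearSource_of_screeningOscillation : (∀ μ : ℝ, 0 < μ → ∃ j : ℕ, ∃ F : Finset (Site 3), F.Nonempty ∧ (∀ u ∈ F, u 2 ≠ 0) ∧ (∀ᶠ k : ℕ in atTop, ∀ K : ℕ, k < K → ∀ᶠ n : ℕ in atTop, ∀ T : Finset (Site 3), T ⊆ box 3 (2 ^ (k + 1)) \ box 3 (2 ^ k) → ∑ u ∈ F, screening n T (deepSource k j u) (dn (2 ^ (K + 3))) ≤ #F * (screening n T e₂ (dn (2 ^ (K + 3))) + μ / 2)) ∧ (∀ᶠ K :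 ℕ in atTop, ∀ᶠ n : ℕ in atTop, ∀ T : Finset (Site 3), T ⊆ box 3 n \ box 3 (2 ^ K) → dn (2 ^ (K + 3)) ∉ T → ∑ u ∈ F, screening n T (deepSource K j u) (dn (2 ^ (K + 3))) ≤ #F * (screening n T e₂ (dn (2 ^ (K + 3))) + μ / 2))) → NearSourceInsensitivity :=
  fun h => nearSrc_transfer (fun _ F => ∀ u ∈ F, u 2 ≠ 0) h

/-! ### A multiplicative sufficient condition: the double-ratio (interior-Harnack) form with ONE deep source -/

/-- `⟨σ_aσ_b⟩_{Λ_n} > 0` for `a, b ∈ Λ_n` (`β_c(3) > 0`; the pair `{a} ∆ {b}` is even). [folklore] -/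
theorem nearSrc_boxTwoPoint_empty_pos {n : ℕ} {a b : Site 3} (ha : a ∈ box 3 n) (hb : b ∈ box 3 n) :
    0 < boxTwoPoint n ∅ a b := by
  have hβ : 0 < criticalBeta 3 := criticalBeta_pos_holds (d := 3) (by norm_num)
  unfold boxTwoPoint
  rw [isingTwoPoint_free_eq_isingCorr_symmDiff, Finset.sdiff_empty]
  refine isingCorr_free_box_pos 3 hβ (pair_symmDiff_subset ha hb) ?_
  by_cases hab : a = b
  · rw [hab, symmDiff_self, Finset.bot_eq_empty, Finset.card_empty]; exact ⟨0, rfl⟩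
  · rw [card_pair_symmDiff hab]; exact even_two

/-- `S⁽ⁿ⁾_{ab}(T) ≤ 1` for `a, b ∈ Λ_n ∖ T` (Griffiths antitonicity from `T = ∅`, where the ratio is `1`). [cite: FriedliVelenik2017, Exercise 3.12] -/
theorem nearSrc_screening_le_one {n : ℕ} {T : Finset (Site 3)} {a b : Site 3} (ha : a ∈ box 3 n \ T)
    (hb : b ∈ box 3 n \ T) : screening n T a b ≤ 1 := by
  have h1 : screening n ∅ a b = 1 := by
    unfold screening
    exact div_self (nearSrc_boxTwoPoint_empty_pos (Finset.mem_sdiff.1 ha).1 (Finset.mem_sdiff.1 hb).1).ne'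
  exact (floorsNec_screening_anti (Finset.empty_subset T) ha hb).trans_eq h1

/-- **Double ratio ⇒ additive oscillation**: if `⟨σ_{a'}σ_b⟩_{Λ_n∖T}·⟨σ_aσ_b⟩_{Λ_n} ≤ (1+ε)·⟨σ_aσ_b⟩_{Λ_n∖T}·⟨σ_{a'}σ_b⟩_{Λ_n}`
(the relative advantage of the source `a'` over `a` is at most `1+ε` times larger off `T` than in the full box),
then `S⁽ⁿ⁾_{a'b}(T) ≤ (1+ε)·S⁽ⁿ⁾_{ab}(T) ≤ S⁽ⁿ⁾_{ab}(T) + ε`. [folklore] -/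
theorem nearSrc_screening_le_of_doubleRatio {n : ℕ} {T : Finset (Site 3)} {a a' b : Site 3} {ε : ℝ} (hε : 0 ≤ ε)
    (ha : a ∈ box 3 n \ T) (ha' : a' ∈ box 3 n \ T) (hb : b ∈ box 3 n \ T)
    (h : boxTwoPoint n T a' b * boxTwoPoint n ∅ a b ≤ (1 + ε) * (boxTwoPoint n T a b * boxTwoPoint n ∅ a' b)) :
    screening n T a' b ≤ screening n T a b + ε := by
  have hDa := nearSrc_boxTwoPoint_empty_pos (Finset.mem_sdiff.1 ha).1 (Finset.mem_sdiff.1 hb).1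
  have hDa' := nearSrc_boxTwoPoint_empty_pos (Finset.mem_sdiff.1 ha').1 (Finset.mem_sdiff.1 hb).1
  have hS1 := nearSrc_screening_le_one ha hb
  have hS0 := floorsRed_screening_nonneg ha hb
  unfold screening at hS1 hS0 ⊢
  set S := boxTwoPoint n T a b / boxTwoPoint n ∅ a b with hS
  have hNa : boxTwoPoint n T a b = S * boxTwoPoint n ∅ a b := (div_mul_cancel₀ _ hDa.ne').symm
  rw [div_le_iff₀ hDa']
  have h1 : boxTwoPoint n T a' b * boxTwoPoint n ∅ a b ≤ (1 + ε) * S * boxTwoPoint n ∅ a' b * boxTwoPoint n ∅ a b :=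
    calc boxTwoPoint n T a' b * boxTwoPoint n ∅ a b ≤ (1 + ε) * (boxTwoPoint n T a b * boxTwoPoint n ∅ a' b) := h
      _ = (1 + ε) * S * boxTwoPoint n ∅ a' b * boxTwoPoint n ∅ a b := by rw [hNa]; ring
  have h2 : boxTwoPoint n T a' b ≤ (1 + ε) * S * boxTwoPoint n ∅ a' b := le_of_mul_le_mul_right h1 hDa
  have h3 : (1 + ε) * S ≤ S + ε := by nlinarith
  exact h2.trans (mul_le_mul_of_nonneg_right h3 hDa'.le)

/-- Coordinates of the deep source `2^{k-j}e₃ = (0,0,2^{k-j})`. [folklore] -/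
theorem nearSrc_deepSource_e₃_coords (k j : ℕ) :
    deepSource k j (Pi.single 2 1) 0 = 0 ∧ deepSource k j (Pi.single 2 1) 1 = 0 ∧
      deepSource k j (Pi.single 2 1) 2 = ((2 ^ (k - j) : ℕ) : ℤ) := by
  refine ⟨?_, ?_, ?_⟩ <;> simp [deepSource]

/-- The deep source `2^{k-j}e₃` lies in `Λ_{2^k}` (for every `j`: truncated subtraction). [folklore] -/
theorem nearSrc_deepSource_e₃_mem_box (k j : ℕ) :
    deepSource k j (Pi.single 2 1) ∈ box 3 (2 ^ k) := by
  have hle : 2 ^ (k - j) ≤ 2 ^ k := Nat.pow_le_pow_right (by norm_num) (Nat.sub_le k j)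
  have hle' : ((2 ^ (k - j) : ℕ) : ℤ) ≤ ((2 ^ k : ℕ) : ℤ) := by exact_mod_cast hle
  have h0' : (0 : ℤ) ≤ ((2 ^ (k - j) : ℕ) : ℤ) := by positivity
  obtain ⟨h0, h1, h2⟩ := nearSrc_deepSource_e₃_coords k j
  rw [mem_box_three, h0, h1, h2]
  omega

/-- Box memberships of the probe points at an octave `k < K`, far scale `M = 2^{K+3}`, obstacle `T ⊆ Λ_{2^{k+1}} ∖ Λ_{2^k}`,
for `n ≥ 2M+1`: `e₂`, `2^{k-j}e₃`, `dn M ∈ Λ_n ∖ T`. [folklore] -/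
theorem nearSrc_mem_octave {k K n : ℕ} (j : ℕ) (hkK : k < K) (hn : 2 * 2 ^ (K + 3) + 1 ≤ n)
    {T : Finset (Site 3)} (hT : T ⊆ box 3 (2 ^ (k + 1)) \ box 3 (2 ^ k)) :
    (e₂ : Site 3) ∈ box 3 n \ T ∧ deepSource k j (Pi.single 2 1) ∈ box 3 n \ T ∧ dn (2 ^ (K + 3)) ∈ box 3 n \ T := by
  obtain ⟨-, he, hdn⟩ := floorsRed_mem_box hn
  have hkn : 2 ^ k ≤ n := by
    have h1 : 2 ^ k ≤ 2 ^ (K + 3) := Nat.pow_le_pow_right (by norm_num) (by omega)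
    omega
  have hoffT : ∀ x : Site 3, x ∈ box 3 (2 ^ k) → x ∉ T := fun x hx hxT => (Finset.mem_sdiff.1 (hT hxT)).2 hx
  have he₂k : (e₂ : Site 3) ∈ box 3 (2 ^ k) := by
    obtain ⟨h0, h1, h2⟩ := e₂_coords
    have : (1 : ℤ) ≤ 2 ^ k := by exact_mod_cast Nat.one_le_two_pow
    rw [mem_box_three, h0, h1, h2]; push_cast; omega
  have hv := nearSrc_deepSource_e₃_mem_box k j
  refine ⟨Finset.mem_sdiff.2 ⟨he, hoffT _ he₂k⟩, Finset.mem_sdiff.2 ⟨box_mono 3 hkn hv, hoffT _ hv⟩,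
    Finset.mem_sdiff.2 ⟨hdn, fun hdT => ?_⟩⟩
  have hdk : dn (2 ^ (K + 3)) ∈ box 3 (2 ^ (k + 1)) := (Finset.mem_sdiff.1 (hT hdT)).1
  obtain ⟨hd0, -, -⟩ := dn_coords (2 ^ (K + 3))
  have hlt : 2 ^ (k + 1) < 2 * 2 ^ (K + 3) :=
    lt_of_lt_of_le (Nat.pow_lt_pow_right (by norm_num) (by omega : k + 1 < K + 3)) (by omega)
  have hlt' : ((2 ^ (k + 1) : ℕ) : ℤ) < ((2 * 2 ^ (K + 3) : ℕ) : ℤ) := by exact_mod_cast hlt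
  rw [mem_box_three, hd0] at hdk
  push_cast at hdk hlt'
  omega

/-- Box memberships at a bulk step `K`, obstacle `T ⊆ Λ_n ∖ Λ_{2^K}` off `dn M`: `e₂`, `2^{K-j}e₃`, `dn M ∈ Λ_n ∖ T`
for `n ≥ 2M+1`. [folklore] -/
theorem nearSrc_mem_bulk {K n : ℕ} (j : ℕ) (hn : 2 * 2 ^ (K + 3) + 1 ≤ n) {T : Finset (Site 3)}
    (hT : T ⊆ box 3 n \ box 3 (2 ^ K)) (hdT : dn (2 ^ (K + 3)) ∉ T) :
    (e₂ : Site 3) ∈ box 3 n \ T ∧ deepSource K j (Pi.single 2 1) ∈ box 3 n \ T ∧ dn (2 ^ (K + 3)) ∈ box 3 n \ T := by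
  obtain ⟨-, he, hdn⟩ := floorsRed_mem_box hn
  have hKn : 2 ^ K ≤ n := by
    have h1 : 2 ^ K ≤ 2 ^ (K + 3) := Nat.pow_le_pow_right (by norm_num) (by omega)
    omega
  have hoffT : ∀ x : Site 3, x ∈ box 3 (2 ^ K) → x ∉ T := fun x hx hxT => (Finset.mem_sdiff.1 (hT hxT)).2 hx
  have he₂K : (e₂ : Site 3) ∈ box 3 (2 ^ K) := by
    obtain ⟨h0, h1, h2⟩ := e₂_coords
    have : (1 : ℤ) ≤ 2 ^ K := by exact_mod_cast Nat.one_le_two_pow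
    rw [mem_box_three, h0, h1, h2]; push_cast; omega
  have hv := nearSrc_deepSource_e₃_mem_box K j
  exact ⟨Finset.mem_sdiff.2 ⟨he, hoffT _ he₂K⟩, Finset.mem_sdiff.2 ⟨box_mono 3 hKn hv, hoffT _ hv⟩,
    Finset.mem_sdiff.2 ⟨hdn, hdT⟩⟩

/-- **NEAR-SOURCE INSENSITIVITY FROM THE DOUBLE-RATIO BOUND WITH ONE DEEP SOURCE** (the interior-Harnack form of the
missing input, in the vocabulary of the depleted box two-point function only). IF for every `ε > 0` there is a
granularity `j` such that, for all large `k`, every `K > k`, all large `n` and every obstacle `T ⊆ Λ_{2^{k+1}} ∖ Λ_{2^k}`,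
with `v = 2^{k-j}e₃`, `z = dn 2^{K+3}`:  `⟨σ_vσ_z⟩_{Λ_n∖T}·⟨σ_{e₂}σ_z⟩_{Λ_n} ≤ (1+ε)·⟨σ_{e₂}σ_z⟩_{Λ_n∖T}·⟨σ_vσ_z⟩_{Λ_n}`
(and the bulk analogue for `T ⊆ Λ_n ∖ Λ_{2^K}` off `z`, `v = 2^{K-j}e₃`), THEN `NearSourceInsensitivity` holds with the
singleton family `F = {e₃}`. This is `nearSource_of_screeningOscillation` with `μ/2 = ε`: the double ratio gives
`S_v(T) ≤ (1+ε)S_{e₂}(T) ≤ S_{e₂}(T) + ε`. The hypothesis — regularity of `a ↦ ⟨σ_aσ_z⟩_D` over interior points `a`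
at depth `2^j` inside `Λ_{2^k} ⊆ D`, uniformly in the scale `k` (for the Gaussian free field: the elliptic Harnack
inequality) — is NOT proved here; it is the `ℤ³` analogue, in ratio form, of the source-relocation line of
Aizenman–Duminil-Copin 2021 Thm 6.4. [cite: AizenmanDuminilCopinAnnals2021, §6.2, Thm 6.4] -/
theorem nearSource_of_twoPointDoubleRatio : (∀ ε : ℝ, 0 < ε → ∃ j : ℕ, (∀ᶠ k : ℕ in atTop, ∀ K : ℕ, k < K → ∀ᶠ n : ℕ in atTop, ∀ T : Finset (Site 3), T ⊆ box 3 (2 ^ (k + 1)) \ box 3 (2 ^ k) → boxTwoPoint n T (deepSource k j (Pi.single 2 1)) (dn (2 ^ (K + 3))) * boxTwoPoint n ∅ e₂ (dn (2 ^ (K + 3))) ≤ (1 + ε) * (boxTwoPoint n T e₂ (dn (2 ^ (K + 3))) * boxTwoPoint n ∅ (deepSource k j (Pi.single 2 1)) (dn (2 ^ (K + 3))))) ∧ (∀ᶠ K : ℕ in atTop, ∀ᶠ n : ℕ in atTop, ∀ T : Finset (Site 3), T ⊆ box 3 n \ box 3 (2 ^ K) → dn (2 ^ (K + 3)) ∉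 T → boxTwoPoint n T (deepSource K j (Pi.single 2 1)) (dn (2 ^ (K + 3))) * boxTwoPoint n ∅ e₂ (dn (2 ^ (K + 3))) ≤ (1 + ε) * (boxTwoPoint n T e₂ (dn (2 ^ (K + 3))) * boxTwoPoint n ∅ (deepSource K j (Pi.single 2 1)) (dn (2 ^ (K + 3)))))) → NearSourceInsensitivity := by
  intro h
  refine nearSource_of_screeningOscillation fun μ hμ => ?_
  obtain ⟨j, hoct, hbulk⟩ := h (μ / 2) (half_pos hμ)
  have hμ2 : 0 ≤ μ / 2 := by positivity
  refine ⟨j, {Pi.single 2 1}, Finset.singleton_nonempty _, fun u hu => ?_, ?_, ?_⟩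
  · rw [Finset.mem_singleton.1 hu]; simp
  · filter_upwards [hoct] with k hk K hkK
    filter_upwards [hk K hkK, eventually_ge_atTop (2 * 2 ^ (K + 3) + 1)] with n hn hn' T hT
    obtain ⟨he, hv, hd⟩ := nearSrc_mem_octave j hkK hn' hT
    rw [Finset.sum_singleton, Finset.card_singleton, Nat.cast_one, one_mul]
    exact nearSrc_screening_le_of_doubleRatio hμ2 he hv hd (hn T hT)
  · filter_upwards [hbulk] with K hK
    filter_upwards [hK, eventually_ge_atTop (2 * 2 ^ (K + 3) + 1)] with n hn hn' T hT hdT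
    obtain ⟨he, hv, hd⟩ := nearSrc_mem_bulk j hn' hT hdT
    rw [Finset.sum_singleton, Finset.card_singleton, Nat.cast_one, one_mul]
    exact nearSrc_screening_le_of_doubleRatio hμ2 he hv hd (hn T hT hdT)

end Summit.CriticalPhenomena.Ising3DConformalLimit.EnergyNotSigmaSquaredGapForcesFarMerging

end
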